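import Summits.CriticalPhenomena.Ising3D.TaylorTableOddCoeffTM2
import HarnessLib

/-!
# The TABLE layer XXIVb: τ-dependent coefficient lists, the quadratic conv, the synthetic-division core, one recursion entry
(cell `pub-ising3x`, seat boot-1 gen 15/16; the MERGED-2 (first-order) odd-head test chain, landed per LEAN-PLAN-MERGED2 in ten modules)

HONEST FRAMING: lottery ticket; floor = tightest certified 3D Ising CFT bounds; no exact-solution
claim without a proof. Island framing: certified exclusion region at stated derivative order and
assumptions; not a determination of the 3D Ising critical exponents beyond that.

Drafted and kernel-checked as one combined file (oddtest2/lean-draft/Merged2CellCombined.lean, 83 theorems, standard axioms); landed in slices of ≤ 400 lines. [folklore]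
-/

namespace Summit.CriticalPhenomena.Ising3D

open Finset Set
open Literature.Analysis.ValidatedNumerics Literature.Analysis.ValidatedNumerics.PolyMP
open Literature.Analysis.ValidatedNumerics.NumericsMP
open Literature.MathematicalPhysics.QuantumFieldTheory.ConformalBootstrap3D
open Literature.MathematicalPhysics.QuantumFieldTheory.ConformalBootstrap3D.HRTM
open Literature.MathematicalPhysics.QuantumFieldTheory.ConformalBootstrap3D.PointKernel (mulQ mem_mulQ legendreLamQ)

namespace HRTMAB2

/-! ### Coefficient lists of τ-dependent functions and the quadratic convolution -/

/-- Memberwise: the `k`-th coefficient FUNCTION of `τ` lies in the `k`-th triple. [folklore] -/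
def TPMem (S : ℕ) (W : ℝ) (as : List (ℝ → ℝ)) (P : TPoly) : Prop := List.Forall₂ (fun a x => T3.Mem S W a x) as P

/-- Coefficient access for function lists (zero function beyond the end). [folklore] -/
def cfF (as : List (ℝ → ℝ)) (k : ℕ) : ℝ → ℝ := as.getD k (fun _ => 0)

/-- [folklore] -/
theorem mem_cfF {S : ℕ} {W : ℝ} : ∀ {as : List (ℝ → ℝ)} {P : TPoly}, TPMem S W as P → ∀ k : ℕ, T3.Mem S W (cfF as k) (cf2 P k)
  | _, _, List.Forall₂.nil, k => by simpa [cfF, cf2] using T3.mem_zero S W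
  | _, _, List.Forall₂.cons h t, 0 => by simpa [cfF, cf2] using h
  | _, _, List.Forall₂.cons (a := a) (b := x) h t, k + 1 => by
      have ih := mem_cfF t k
      simpa [cfF, cf2] using ih

/-- **Membership of the quadratic convolution coefficient** `k`: `a_k·g₀ + a_{k−1}·g₁ + a_{k−2}·g₂` (as functions of `τ`). [folklore] -/
theorem mem_conv3I2 {S : ℕ} (hS : 0 < S) {Wn : ℤ} {Wd : ℕ} (hWd : 0 < Wd) {as : List (ℝ → ℝ)} {P : TPoly}
    (hP : TPMem S ((Wn : ℝ) / Wd) as P) {g0 g1 g2 : ℝ → ℝ} {G0 G1 G2 : T3}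
    (h0 : T3.Mem S ((Wn : ℝ) / Wd) g0 G0) (h1 : T3.Mem S ((Wn : ℝ) / Wd) g1 G1) (h2 : T3.Mem S ((Wn : ℝ) / Wd) g2 G2) (k : ℕ) :
    T3.Mem S ((Wn : ℝ) / Wd)
      (fun τ => cfF as k τ * g0 τ + (if 1 ≤ k then cfF as (k - 1) τ * g1 τ else 0) + (if 2 ≤ k then cfF as (k - 2) τ * g2 τ else 0))
      (conv3I2 S Wn Wd G0 G1 G2 P k) := by
  have m0 := T3.mem_mul hS hWd (mem_cfF hP k) h0
  unfold conv3I2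
  by_cases hk1 : 1 ≤ k
  · by_cases hk2 : 2 ≤ k
    · simp only [hk1, hk2, if_true]
      have m1 := T3.mem_mul hS hWd (mem_cfF hP (k - 1)) h1
      have m2 := T3.mem_mul hS hWd (mem_cfF hP (k - 2)) h2
      exact (T3.Mem_congr (fun τ => by ring)).mp (T3.mem_add (T3.mem_add m0 m1) m2)
    · simp only [hk1, hk2, if_true, if_false, add_zero]
      have m1 := T3.mem_mul hS hWd (mem_cfF hP (k - 1)) h1
      exact (T3.Mem_congr (fun τ => by ring)).mp (T3.mem_add m0 m1)
  · have hk2 : ¬ 2 ≤ k := by omega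
    simp only [hk1, hk2, if_false, add_zero]
    exact (T3.Mem_congr (fun τ => by ring)).mp m0

/-! ### The synthetic-division core of `HRTMI.tmem_entryI`, extracted (numerators given abstractly) — used once per τ-component -/

/-- **Division core.** If the real numerator coefficients `ν k ∈ num k` satisfy `Σ_{k<D+3} ν_k ρ^k = (p₀ + p₁ρ)·fρ` at one `ρ` with `|ρ| ≤ 2^{-e}`
and the pivot margin is positive, then `fρ` is the value at `ρ` of a member of `widen0 (bList num p₀ p₁ D).reverse ⌈rn/m⌉` — literally the list
`divComp` builds for that component (same `r1, r2, rn, m`). (Proof = the second half of `HRTMI.tmem_entryI`, verbatim.) [folklore] -/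
theorem divCore {S e D : ℕ} (hS : 0 < S) {num : ℕ → MI} {ν : ℕ → ℝ} (hν : ∀ k, MI.mem S (ν k) (num k))
    {p0 p1 : ℚ} (hm : 0 < pivMargin e p0 p1) {ρ : ℝ} (hρ : |ρ| ≤ 1 / 2 ^ e) {fρ : ℝ}
    (hN : ∑ k ∈ range (D + 3), ν k * ρ ^ k = ((p0 : ℝ) + p1 * ρ) * fρ) :
    ∃ bs : List ℝ, PMem S bs (widen0 (bList num p0 p1 D).reverse (remOf e D p0 p1 num)) ∧ fρ = evalR bs ρ := by
  have h0 : (0 : ℝ) ≤ 1 / 2 ^ e := by positivity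
  have hmR : (0 : ℝ) < |(p0 : ℝ)| - |(p1 : ℝ)| / 2 ^ e := by
    have : ((pivMargin e p0 p1 : ℚ) : ℝ) = |(p0 : ℝ)| - |(p1 : ℝ)| / 2 ^ e := by
      simp only [pivMargin]; push_cast; ring
    rw [← this]; exact_mod_cast hm
  have hp0 : (p0 : ℝ) ≠ 0 := by
    intro h; rw [h, abs_zero] at hmR
    have : (0 : ℝ) ≤ |(p1 : ℝ)| / 2 ^ e := by positivity
    linarith
  have hpiv : |(p0 : ℝ)| - |(p1 : ℝ)| / 2 ^ e ≤ |(p0 : ℝ) + p1 * ρ| := pivMargin_le_abs p0 p1 hρ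
  have hsd := sd_identity ν (p1 : ℝ) ρ hp0 D
  set B : ℝ := ∑ k ∈ range (D + 1), bR ν p0 p1 k * ρ ^ k with hB
  set δ : ℝ := fρ - B with hδdef
  have hT : ((p0 : ℝ) + p1 * ρ) * δ =
      ρ ^ (D + 1) * ((ν (D + 1) - p1 * bR ν p0 p1 D) + ν (D + 2) * ρ) := by
    have e3 : ∑ k ∈ range (D + 3), ν k * ρ ^ k =
        ∑ k ∈ range (D + 1), ν k * ρ ^ k + ν (D + 1) * ρ ^ (D + 1) + ν (D + 2) * ρ ^ (D + 2) := by
      rw [show D + 3 = D + 1 + 1 + 1 by omega, sum_range_succ, sum_range_succ]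
    rw [hδdef, mul_sub, ← hN, e3, hsd]; ring
  have hbD : MI.mem S (bR ν p0 p1 D) ((bList num p0 p1 D).headD zI) := by
    rw [headD_bList]; exact mem_bI hν p0 p1 D
  have hr1 := MI.abs_le_absHi (MI.mem_sub (hν (D + 1)) (mem_mulQ hbD p1))
  have hr2 := MI.abs_le_absHi (hν (D + 2))
  set r1 : ℤ := (MI.sub (num (D + 1)) (mulQ ((bList num p0 p1 D).headD zI) p1)).absHi with hr1def
  set r2 : ℤ := (num (D + 2)).absHi with hr2def
  have hr1nn : (0 : ℝ) ≤ r1 := by exact_mod_cast absHi_nonneg _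
  have hr2nn : (0 : ℝ) ≤ r2 := by exact_mod_cast absHi_nonneg _
  have hS0 : (0 : ℝ) ≤ S := by positivity
  have hkey : |δ| * S * (|(p0 : ℝ)| - |(p1 : ℝ)| / 2 ^ e) ≤
      r1 * (1 / 2 ^ e) ^ (D + 1) + r2 * (1 / 2 ^ e) ^ (D + 2) := by
    have h1 : |δ| * (|(p0 : ℝ)| - |(p1 : ℝ)| / 2 ^ e) ≤ |δ| * |(p0 : ℝ) + p1 * ρ| :=
      mul_le_mul_of_nonneg_left hpiv (abs_nonneg _)
    have h2 : |δ| * |(p0 : ℝ) + p1 * ρ| =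
        |ρ| ^ (D + 1) * |(ν (D + 1) - p1 * bR ν p0 p1 D) + ν (D + 2) * ρ| := by
      rw [← abs_mul, mul_comm, hT, abs_mul, abs_pow]
    have h3 : |ρ| ^ (D + 1) ≤ (1 / 2 ^ e) ^ (D + 1) := pow_le_pow_left₀ (abs_nonneg _) hρ _
    have h4 : |(ν (D + 1) - p1 * bR ν p0 p1 D) + ν (D + 2) * ρ| * S ≤ r1 + r2 * (1 / 2 ^ e) := by
      have h41 : |(ν (D + 1) - p1 * bR ν p0 p1 D) + ν (D + 2) * ρ| ≤
          |ν (D + 1) - bR ν p0 p1 D * p1| + |ν (D + 2)| * |ρ| := by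
        rw [← abs_mul, mul_comm (p1 : ℝ)]; exact abs_add_le _ _
      have h42 : |ν (D + 2)| * |ρ| * S ≤ r2 * (1 / 2 ^ e) := by
        have := mul_le_mul hr2 hρ (abs_nonneg _) hr2nn
        calc |ν (D + 2)| * |ρ| * S = |ν (D + 2)| * S * |ρ| := by ring
          _ ≤ r2 * (1 / 2 ^ e) := this
      nlinarith [abs_nonneg ρ, abs_nonneg (ν (D + 2))]
    have h5 : (0 : ℝ) ≤ |(ν (D + 1) - p1 * bR ν p0 p1 D) + ν (D + 2) * ρ| := abs_nonneg _
    calc |δ| * S * (|(p0 : ℝ)| - |(p1 : ℝ)| / 2 ^ e)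
        = |δ| * (|(p0 : ℝ)| - |(p1 : ℝ)| / 2 ^ e) * S := by ring
      _ ≤ |δ| * |(p0 : ℝ) + p1 * ρ| * S := mul_le_mul_of_nonneg_right h1 hS0
      _ = |ρ| ^ (D + 1) * (|(ν (D + 1) - p1 * bR ν p0 p1 D) + ν (D + 2) * ρ| * S) := by rw [h2]; ring
      _ ≤ (1 / 2 ^ e) ^ (D + 1) * (r1 + r2 * (1 / 2 ^ e)) :=
          mul_le_mul h3 h4 (by positivity) (by positivity)
      _ = r1 * (1 / 2 ^ e) ^ (D + 1) + r2 * (1 / 2 ^ e) ^ (D + 2) := by ring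
  set rn : ℤ := r1 / (2 ^ (e * (D + 1)) : ℤ) + r2 / (2 ^ (e * (D + 2)) : ℤ) + 2 with hrn
  have hrnR : r1 * (1 / 2 ^ e : ℝ) ^ (D + 1) + r2 * (1 / 2 ^ e : ℝ) ^ (D + 2) ≤ rn := by
    have g1 := real_div_le_ediv_add_one r1 (d := 2 ^ (e * (D + 1))) (by positivity)
    have g2 := real_div_le_ediv_add_one r2 (d := 2 ^ (e * (D + 2))) (by positivity)
    push_cast at g1 g2
    have f1 : (r1 : ℝ) * (1 / 2 ^ e : ℝ) ^ (D + 1) = (r1 : ℝ) / (2 : ℝ) ^ (e * (D + 1)) := by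
      rw [pow_mul]; ring
    have f2 : (r2 : ℝ) * (1 / 2 ^ e : ℝ) ^ (D + 2) = (r2 : ℝ) / (2 : ℝ) ^ (e * (D + 2)) := by
      rw [pow_mul]; ring
    rw [f1, f2, hrn]; push_cast; linarith
  set m : ℚ := |p0| - |p1| / (2 ^ e : ℚ) with hmdef
  have hmR' : ((m : ℚ) : ℝ) = |(p0 : ℝ)| - |(p1 : ℝ)| / 2 ^ e := by
    simp only [hmdef]; push_cast; ring
  have hδ : |δ| * S ≤ ((⌈(rn : ℚ) / m⌉ : ℤ) : ℝ) := by
    have hmpos : (0 : ℝ) < ((m : ℚ) : ℝ) := by rw [hmR']; exact hmR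
    have h1 : |δ| * S ≤ (rn : ℝ) / ((m : ℚ) : ℝ) := by
      rw [le_div_iff₀ hmpos, hmR']; exact hkey.trans hrnR
    have h2 : (rn : ℝ) / ((m : ℚ) : ℝ) ≤ ((⌈(rn : ℚ) / m⌉ : ℤ) : ℝ) := by
      have := Int.le_ceil ((rn : ℚ) / m)
      have h3 : (((rn : ℚ) / m : ℚ) : ℝ) ≤ ((⌈(rn : ℚ) / m⌉ : ℤ) : ℝ) := by exact_mod_cast this
      simpa using h3
    exact h1.trans h2
  have hPB : PMem S ((List.range (D + 1)).map (bR ν p0 p1)) (bList num p0 p1 D).reverse := by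
    rw [reverse_bList]; exact pmem_map_range (D + 1) (mem_bI hν p0 p1)
  have hδ' : |δ| * S ≤ ((remOf e D p0 p1 num : ℤ) : ℝ) := by
    have hdef : remOf e D p0 p1 num = ⌈(rn : ℚ) / m⌉ := rfl
    rw [hdef]; exact hδ
  obtain ⟨bs, hbs, ebs⟩ := exists_widen0 hPB hδ' ρ
  exact ⟨bs, hbs, by rw [ebs, evalR_map_range, ← hB, hδdef]; ring⟩

/-! ### Two-variable Taylor-model membership and list helpers -/

/-- `Σ_k a_k(τ) ρ^k` (Horner in `ρ`). [folklore] -/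
noncomputable def evalF : List (ℝ → ℝ) → ℝ → ℝ → ℝ
  | [], _, _ => 0
  | a :: as, ρ, τ => a τ + ρ * evalF as ρ τ

/-- **Membership of a two-variable function in a triple Taylor model**: pointwise in `ρ` (as `TMem`), with `τ`-coefficient FUNCTIONS in the
triples (a semantics predicate of this development). [folklore] -/
def TMem2 (S : ℕ) (h : ℚ) (W : ℝ) (F : ℝ → ℝ → ℝ) (P : TPoly) : Prop :=
  ∀ ρ : ℝ, |ρ| ≤ h → ∃ as : List (ℝ → ℝ), TPMem S W as P ∧ ∀ τ : ℝ, |τ| ≤ W → F ρ τ = evalF as ρ τ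

/-- `evalF` at a fixed `τ` is `evalR` of the evaluated list. [folklore] -/
theorem evalF_eq_evalR_map (ρ τ : ℝ) : ∀ as : List (ℝ → ℝ), evalF as ρ τ = evalR (as.map fun a => a τ) ρ
  | [] => by simp [evalF]
  | a :: as => by simp only [evalF, List.map_cons, evalR, evalF_eq_evalR_map ρ τ as]

/-- `cfF` at a fixed `τ` is `getD` of the evaluated list. [folklore] -/
theorem cfF_apply (as : List (ℝ → ℝ)) (k : ℕ) (τ : ℝ) : cfF as k τ = (as.map fun a => a τ).getD k 0 := by
  simp only [cfF, List.getD_eq_getElem?_getD, List.getElem?_map]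
  cases as[k]? <;> simp

/-- `evalF` of a tabulated list. [folklore] -/
theorem evalF_map_range (a : ℕ → ℝ → ℝ) (ρ τ : ℝ) : ∀ K : ℕ,
    evalF ((List.range K).map a) ρ τ = ∑ k ∈ range K, a k τ * ρ ^ k
  | 0 => by simp [evalF]
  | K + 1 => by
      rw [List.range_succ_eq_map, List.map_cons, List.map_map, evalF, evalF_map_range (a ∘ Nat.succ) ρ τ K,
        Finset.sum_range_succ']
      simp only [Function.comp, Nat.succ_eq_add_one, pow_succ, pow_zero, mul_one]
      rw [Finset.mul_sum, add_comm]
      congr 1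
      exact Finset.sum_congr rfl fun k _ => by ring

/-- `TPMem` of two tabulations. [folklore] -/
theorem tpmem_map_range {S : ℕ} {W : ℝ} : ∀ (K : ℕ) {f : ℕ → ℝ → ℝ} {F : ℕ → T3}, (∀ k, T3.Mem S W (f k) (F k)) →
    TPMem S W ((List.range K).map f) ((List.range K).map F)
  | 0, _, _, _ => List.Forall₂.nil
  | K + 1, f, F, h => by
      rw [List.range_succ_eq_map, List.map_cons, List.map_cons, List.map_map, List.map_map]
      exact List.Forall₂.cons (h 0) (tpmem_map_range K (f := f ∘ Nat.succ) (F := F ∘ Nat.succ) fun k => h (k + 1))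

/-- Length of a `TPMem` pair. [folklore] -/
theorem TPMem.length_eq {S : ℕ} {W : ℝ} {as : List (ℝ → ℝ)} {P : TPoly} (h : TPMem S W as P) : as.length = P.length :=
  List.Forall₂.length_eq h

/-! ### Soundness of one recursion entry with τ-triple numerators -/

set_option maxHeartbeats 800000 in
/-- **One recursion entry, τ-triple version.** If `fp ∈ Pp`, `fm ∈ Pm` (two-variable models), the six numerator coefficient functions of `τ`
lie in the triples `Gp`, `Gm`, the pivot margin is positive and `(p₀ + p₁ρ)·f(ρ,τ) = Gp(ρ,τ)·fp(ρ,τ) + Gm(ρ,τ)·fm(ρ,τ)` on the cell, then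
`f ∈ entryTMI2 …`. Proof: the numerator coefficient functions lie in the tabulated triples (`mem_conv3I2`); their fixed `τ⁰/τ¹` parts and,
for each `τ`, their `τ²` parts are divided by the pivot separately (`divCore`, three times); the three quotients recombine because the pivot
does not depend on `τ`. [folklore] -/
theorem tmem_entryTMI2 {S e D : ℕ} (hS : 0 < S) {Wn : ℤ} {Wd : ℕ} (hWd : 0 < Wd)
    {Gp Gm : T3 × T3 × T3} {gp0 gp1 gp2 gm0 gm1 gm2 : ℝ → ℝ}
    (hgp0 : T3.Mem S ((Wn : ℝ) / Wd) gp0 Gp.1) (hgp1 : T3.Mem S ((Wn : ℝ) / Wd) gp1 Gp.2.1) (hgp2 : T3.Mem S ((Wn : ℝ) / Wd) gp2 Gp.2.2)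
    (hgm0 : T3.Mem S ((Wn : ℝ) / Wd) gm0 Gm.1) (hgm1 : T3.Mem S ((Wn : ℝ) / Wd) gm1 Gm.2.1) (hgm2 : T3.Mem S ((Wn : ℝ) / Wd) gm2 Gm.2.2)
    {p0 p1 : ℚ} {Pp Pm : TPoly} {fp fm f : ℝ → ℝ → ℝ}
    (hPp : TMem2 S ((1 : ℚ) / 2 ^ e) ((Wn : ℝ) / Wd) fp Pp) (hPm : TMem2 S ((1 : ℚ) / 2 ^ e) ((Wn : ℝ) / Wd) fm Pm)
    (hlp : Pp.length ≤ D + 1) (hlm : Pm.length ≤ D + 1) (hm : 0 < pivMargin e p0 p1)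
    (hrec : ∀ ρ τ : ℝ, |ρ| ≤ (((1 : ℚ) / 2 ^ e : ℚ) : ℝ) → |τ| ≤ (Wn : ℝ) / Wd →
      ((p0 : ℝ) + p1 * ρ) * f ρ τ =
        (gp0 τ + gp1 τ * ρ + gp2 τ * ρ ^ 2) * fp ρ τ + (gm0 τ + gm1 τ * ρ + gm2 τ * ρ ^ 2) * fm ρ τ) :
    TMem2 S ((1 : ℚ) / 2 ^ e) ((Wn : ℝ) / Wd) f (entryTMI2 S e D Wn Wd Gp Gm p0 p1 Pp Pm) := by
  intro ρ hρ
  obtain ⟨asp, hasp, efp⟩ := hPp ρ hρ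
  obtain ⟨asm, hasm, efm⟩ := hPm ρ hρ
  have hh : ((((1 : ℚ) / 2 ^ e : ℚ)) : ℝ) = 1 / 2 ^ e := by push_cast; ring
  have hρ' : |ρ| ≤ 1 / 2 ^ e := by rw [hh] at hρ; exact hρ
  -- the numerator coefficient triples and functions
  let num3 : ℕ → T3 := fun k =>
    T3.add (conv3I2 S Wn Wd Gp.1 Gp.2.1 Gp.2.2 Pp k) (conv3I2 S Wn Wd Gm.1 Gm.2.1 Gm.2.2 Pm k)
  let nf : ℕ → ℝ → ℝ := fun k τ =>
    (cfF asp k τ * gp0 τ + (if 1 ≤ k then cfF asp (k - 1) τ * gp1 τ else 0) + (if 2 ≤ k then cfF asp (k - 2) τ * gp2 τ else 0)) +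
    (cfF asm k τ * gm0 τ + (if 1 ≤ k then cfF asm (k - 1) τ * gm1 τ else 0) + (if 2 ≤ k then cfF asm (k - 2) τ * gm2 τ else 0))
  have hn : ∀ k, T3.Mem S ((Wn : ℝ) / Wd) (nf k) (num3 k) := fun k =>
    T3.mem_add (mem_conv3I2 hS hWd hasp hgp0 hgp1 hgp2 k) (mem_conv3I2 hS hWd hasm hgm0 hgm1 hgm2 k)
  choose ν0 ν1 hν0 hν1 hrest using hn
  have hget : ∀ k, (vtab (D + 3) num3).getD k T3.zero = if k < D + 3 then num3 k else T3.zero :=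
    fun k => getD_vtab _ _ _ _
  -- truncated component sequences and their memberships in divComp's `num`
  have hν0' : ∀ k, MI.mem S (if k < D + 3 then ν0 k else 0) ((vtab (D + 3) num3).getD k T3.zero).c0 := by
    intro k; rw [hget]
    by_cases hk : k < D + 3
    · simp only [hk, if_true]; exact hν0 k
    · simp only [hk, if_false]; exact mem_zI S
  have hν1' : ∀ k, MI.mem S (if k < D + 3 then ν1 k else 0) ((vtab (D + 3) num3).getD k T3.zero).c1 := by
    intro k; rw [hget]
    by_cases hk : k < D + 3
    · simp only [hk, if_true]; exact hν1 k
    · simp only [hk, if_false]; exact mem_zI S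
  -- pivot
  have hmR : (0 : ℝ) < |(p0 : ℝ)| - |(p1 : ℝ)| / 2 ^ e := by
    have : ((pivMargin e p0 p1 : ℚ) : ℝ) = |(p0 : ℝ)| - |(p1 : ℝ)| / 2 ^ e := by
      simp only [pivMargin]; push_cast; ring
    rw [← this]; exact_mod_cast hm
  have hpiv : (p0 : ℝ) + p1 * ρ ≠ 0 := by
    have h1 := pivMargin_le_abs p0 p1 hρ'
    intro h0; rw [h0, abs_zero] at h1; linarith
  -- components 0 and 1
  have sum_if : ∀ (ν : ℕ → ℝ), ∑ k ∈ range (D + 3), (if k < D + 3 then ν k else 0) * ρ ^ k = ∑ k ∈ range (D + 3), ν k * ρ ^ k :=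
    fun ν => Finset.sum_congr rfl fun k hk => by rw [if_pos (Finset.mem_range.mp hk)]
  have hN0 : ∑ k ∈ range (D + 3), (if k < D + 3 then ν0 k else 0) * ρ ^ k =
      ((p0 : ℝ) + p1 * ρ) * ((∑ k ∈ range (D + 3), ν0 k * ρ ^ k) / ((p0 : ℝ) + p1 * ρ)) := by
    rw [sum_if]; field_simp
  have hN1 : ∑ k ∈ range (D + 3), (if k < D + 3 then ν1 k else 0) * ρ ^ k =
      ((p0 : ℝ) + p1 * ρ) * ((∑ k ∈ range (D + 3), ν1 k * ρ ^ k) / ((p0 : ℝ) + p1 * ρ)) := by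
    rw [sum_if]; field_simp
  obtain ⟨bs0, hbs0, e0⟩ := divCore (D := D) hS hν0' hm hρ' hN0
  obtain ⟨bs1, hbs1, e1⟩ := divCore (D := D) hS hν1' hm hρ' hN1
  -- component 2, for every τ
  have comp2 : ∀ τ : ℝ, ∃ bs2 : List ℝ, |τ| ≤ (Wn : ℝ) / Wd →
      PMem S bs2 (divComp e D p0 p1 (vtab (D + 3) num3) T3.c2) ∧
        ∃ ν2 : ℕ → ℝ, (∀ k, nf k τ = ν0 k + ν1 k * τ + ν2 k * τ ^ 2) ∧
          ∑ k ∈ range (D + 3), ν2 k * ρ ^ k = ((p0 : ℝ) + p1 * ρ) * evalR bs2 ρ := by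
    intro τ
    by_cases hτ : |τ| ≤ (Wn : ℝ) / Wd
    · choose c2 hc2 heq using fun k => hrest k τ hτ
      have hν2' : ∀ k, MI.mem S (if k < D + 3 then c2 k else 0) ((vtab (D + 3) num3).getD k T3.zero).c2 := by
        intro k; rw [hget]
        by_cases hk : k < D + 3
        · simp only [hk, if_true]; exact hc2 k
        · simp only [hk, if_false]; exact mem_zI S
      have hN2 : ∑ k ∈ range (D + 3), (if k < D + 3 then c2 k else 0) * ρ ^ k =
          ((p0 : ℝ) + p1 * ρ) * ((∑ k ∈ range (D + 3), c2 k * ρ ^ k) / ((p0 : ℝ) + p1 * ρ)) := by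
        rw [sum_if]; field_simp
      obtain ⟨bs2, hbs2, e2⟩ := divCore (D := D) hS hν2' hm hρ' hN2
      refine ⟨bs2, fun _ => ⟨hbs2, c2, heq, ?_⟩⟩
      rw [← e2]; field_simp
    · exact ⟨[], fun h => absurd h hτ⟩
  choose bs2 hbs2 using comp2
  -- lengths
  have hlenW : ∀ (π : T3 → MI), (divComp e D p0 p1 (vtab (D + 3) num3) π).length = D + 1 := by
    intro π
    simp only [divComp]
    apply length_widen0_of_length
    rw [reverse_bList]; simp
  have hbs0' : PMem S bs0 (divComp e D p0 p1 (vtab (D + 3) num3) T3.c0) := by unfold divComp; exact hbs0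
  have hbs1' : PMem S bs1 (divComp e D p0 p1 (vtab (D + 3) num3) T3.c1) := by unfold divComp; exact hbs1
  have hl0 : bs0.length ≤ D + 1 := by rw [hbs0'.length_eq, hlenW]
  have hl1 : bs1.length ≤ D + 1 := by rw [hbs1'.length_eq, hlenW]
  -- the witness list of coefficient functions
  let a : ℕ → ℝ → ℝ := fun k τ => bs0.getD k 0 + bs1.getD k 0 * τ + (bs2 τ).getD k 0 * τ ^ 2
  refine ⟨(List.range (D + 1)).map a, ?_, ?_⟩
  · -- TPMem in zip3
    show TPMem S ((Wn : ℝ) / Wd) ((List.range (D + 1)).map a)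
      (vtab (D + 1) fun k => (⟨cf (divComp e D p0 p1 (vtab (D + 3) num3) T3.c0) k,
        cf (divComp e D p0 p1 (vtab (D + 3) num3) T3.c1) k, cf (divComp e D p0 p1 (vtab (D + 3) num3) T3.c2) k⟩ : T3))
    exact tpmem_map_range (D + 1) fun k =>
      ⟨bs0.getD k 0, bs1.getD k 0, mem_cf hbs0' k, mem_cf hbs1' k, fun τ hτ =>
        ⟨(bs2 τ).getD k 0, mem_cf (hbs2 τ hτ).1 k, by ring⟩⟩
  · -- the value
    intro τ hτ
    obtain ⟨hP2, ν2, heq, e2⟩ := hbs2 τ hτ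
    have hl2 : (bs2 τ).length ≤ D + 1 := by rw [hP2.length_eq, hlenW]
    rw [evalF_map_range]
    have split : ∑ k ∈ range (D + 1), a k τ * ρ ^ k =
        evalR bs0 ρ + (evalR bs1 ρ) * τ + (evalR (bs2 τ) ρ) * τ ^ 2 := by
      rw [← sum_getD_eq_evalR ρ bs0 (D + 1) hl0, ← sum_getD_eq_evalR ρ bs1 (D + 1) hl1,
        ← sum_getD_eq_evalR ρ (bs2 τ) (D + 1) hl2, Finset.sum_mul, Finset.sum_mul, ← Finset.sum_add_distrib,
        ← Finset.sum_add_distrib]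
      exact Finset.sum_congr rfl fun k _ => by ring
    rw [split]
    -- the numerator identity at this τ
    have hlenp : (asp.map fun g => g τ).length + 2 ≤ D + 3 := by
      rw [List.length_map, hasp.length_eq]; omega
    have hlenm : (asm.map fun g => g τ).length + 2 ≤ D + 3 := by
      rw [List.length_map, hasm.length_eq]; omega
    have hnf : ∀ k, nf k τ = HRTMI.conv3RR (gp0 τ) (gp1 τ) (gp2 τ) (asp.map fun g => g τ) k +
        HRTMI.conv3RR (gm0 τ) (gm1 τ) (gm2 τ) (asm.map fun g => g τ) k := by
      intro k; simp only [nf, HRTMI.conv3RR, cfF_apply]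
    have hN : ∑ k ∈ range (D + 3), nf k τ * ρ ^ k = ((p0 : ℝ) + p1 * ρ) * f ρ τ := by
      have e1' := HRTMI.sum_conv3RR (gp0 τ) (gp1 τ) (gp2 τ) (asp.map fun g => g τ) ρ hlenp
      have e2' := HRTMI.sum_conv3RR (gm0 τ) (gm1 τ) (gm2 τ) (asm.map fun g => g τ) ρ hlenm
      rw [hrec ρ τ hρ hτ, efp τ hτ, efm τ hτ, evalF_eq_evalR_map, evalF_eq_evalR_map]
      simp only [hnf, add_mul, Finset.sum_add_distrib, e1', e2']
    have hsplit : ∑ k ∈ range (D + 3), nf k τ * ρ ^ k =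
        (∑ k ∈ range (D + 3), ν0 k * ρ ^ k) + (∑ k ∈ range (D + 3), ν1 k * ρ ^ k) * τ +
          (∑ k ∈ range (D + 3), ν2 k * ρ ^ k) * τ ^ 2 := by
      rw [Finset.sum_mul, Finset.sum_mul, ← Finset.sum_add_distrib, ← Finset.sum_add_distrib]
      exact Finset.sum_congr rfl fun k _ => by rw [heq k]; ring
    -- assemble: (p0+p1ρ) f = A0 + A1 τ + A2 τ², A0 = piv·evalR bs0, …
    have eA0 : ∑ k ∈ range (D + 3), ν0 k * ρ ^ k = ((p0 : ℝ) + p1 * ρ) * evalR bs0 ρ := by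
      rw [← e0]; field_simp
    have eA1 : ∑ k ∈ range (D + 3), ν1 k * ρ ^ k = ((p0 : ℝ) + p1 * ρ) * evalR bs1 ρ := by
      rw [← e1]; field_simp
    have key : ((p0 : ℝ) + p1 * ρ) * f ρ τ =
        ((p0 : ℝ) + p1 * ρ) * (evalR bs0 ρ + evalR bs1 ρ * τ + evalR (bs2 τ) ρ * τ ^ 2) := by
      rw [← hN, hsplit, eA0, eA1, e2]; ring
    exact mul_left_cancel₀ hpiv key

end HRTMAB2

end Summit.CriticalPhenomena.Ising3D
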